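/-
Lane: what-if / input-certification SUPPORT (d-generic analysis lemma; no table, no named fact,
no statement at a specific dimension).
-/
import Literature.Probability.FitznerVanDerHofstad2017.SrwSqMomRowInputs
import Literature.Probability.FitznerVanDerHofstad2017.SrwIntegralWSplit
import HarnessLib

/-!
# The `U`-row second moment, sharpened: `D̂^{sin} ≤ (1 − D̂²)/d` and
`Sq^{|D̂|^{2j} D̂^{sin}}_n(x) ≤ (W_{n,j}(x) − W_{n,j+1}(x))/d`

[NoBLE17] = Fitzner–van der Hofstad, *Generalized approach to the non-backtracking lace expansion*,
PTRF 169 (2017) 1041–1119 (`FitznerVanDerHofstad2016NoBLE`): §3.3.3 p. 1070 (`D̂^{sin}(k) = d⁻² Σ_s sin² k_s`),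
(3.34)–(3.38) p. 1071 (the second moment `Sq^w_n(x) = ∫ w (D̂^{(x)})² Ĉⁿ` of `D̂^{(x)}` that enters the bound on
`U_{n,l}(x)`), §5.1 (5.4)–(5.9) pp. 1089–1092 (`I_{n,l}`, `L_n = W_{n,0}`, `W_{n,j}`).

The landed `U`-row input `srwSqMom_abs_Dhat_pow_mul_Dsin_le` rests on the crude pointwise bound
`D̂^{sin} ≤ 1/d`.  This module sharpens the pointwise bound by ONE Cauchy–Schwarz (Jensen) step,
`D̂(k)² = (d⁻¹ Σ_s cos k_s)² ≤ d⁻¹ Σ_s cos² k_s`, i.e. `D̂^{sin}(k) = d⁻² (d − Σ_s cos² k_s) ≤ (1 − D̂(k)²)/d`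
(`Dsin_le_one_sub_Dhat_sq_div`); integrating against the non-negative density `(D̂^{(x)})² Ĉⁿ` (`d ≥ 2n+1`)
gives `Sq^{|D̂|^{2j} D̂^{sin}}_n(x) ≤ d⁻¹ (Sq^{|D̂|^{2j}}_n(x) − Sq^{|D̂|^{2j+2}}_n(x)) = d⁻¹ (W_{n,j}(x) − W_{n,j+1}(x))`
(`srwSqMom_abs_Dhat_pow_even_mul_Dsin_le_srwW_sub`).  At an axis node `x = m e_i` both `W`'s are plain seeds
(`srwSqMom_abs_Dhat_pow_even_single_eq`), so the `ℚ`-cast row inputs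
`srwSqMom_abs_Dhat_pow_zero_mul_Dsin_single_le_jensen_cast` (`l = 0`) and
`srwSqMom_abs_Dhat_sq_mul_Dsin_single_le_jensen_cast` (`l = 2`) take UPPER seed bounds for `I_{n,l}` and
LOWER seed bounds for `I_{n,l+2}` at `0`, `2m e_i`, `m e_i + m e_j`.  Finally, at the UNIT axis node `e_i`
the second-moment density is `D̂²` itself (`D̂^{(e_i)} = D̂`), so `Sq^{w}_n(e_i) = Tw^{w·D̂²}_n(·;0)` is a `β = 0`
class mass (`srwSqMom_single_one_eq_srwTwist_zero`, `srwSqMom_abs_Dhat_pow_mul_Dsin_single_one_eq`), to be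
enclosed by the landed pure-class identities (e.g. `srwTwist_abs_Dhat_sq_mul_Dsin_encl` for `w = D̂^{sin}`).

d-GENERIC.  Epistemic status / lane: what-if / input-certification SUPPORT; nothing here is a certificate;
no statement at a specific dimension.

## Main statements
* `Dhat_sq_le_sum_cos_sq_div` — `D̂(k)² ≤ d⁻¹ Σ_s cos²(k_s)`.
* `Dsin_le_one_sub_Dhat_sq_div` — `D̂^{sin}(k) ≤ (1 − D̂(k)²)/d`.
* `srwSqMom_sub_weight` — `Sq^{w₁ − w₂}_n = Sq^{w₁}_n − Sq^{w₂}_n` (bounded measurable weights, `d ≥ 2n+1`).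
* `srwSqMom_abs_Dhat_pow_even_eq_srwW` — `Sq^{|D̂|^{2j}}_n(x) = W_{n,j}(x)`.
* `srwSqMom_abs_Dhat_pow_even_mul_Dsin_le_srwW_sub` — `Sq^{|D̂|^{2j} D̂^{sin}}_n(x) ≤ (W_{n,j}(x) − W_{n,j+1}(x))/d`.
* `srwSqMom_abs_Dhat_pow_zero_mul_Dsin_single_le_jensen_cast`, `srwSqMom_abs_Dhat_sq_mul_Dsin_single_le_jensen_cast`
  — the axis-node `ℚ`-cast row inputs.
* `srwSqMom_single_one_eq_srwTwist_zero`, `srwSqMom_abs_Dhat_pow_mul_Dsin_single_one_eq` — the unit axis node.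

## References
* [NoBLE17] R. Fitzner, R. van der Hofstad, PTRF 169 (2017) 1041–1119 (arXiv:1506.07969), §3.3.3 p. 1070,
  (3.34)–(3.38) p. 1071, §5.1 (5.4)–(5.9) pp. 1089–1092. [FitznerVanDerHofstad2016NoBLE]
[cite: FitznerVanDerHofstad2016NoBLE, §3.3.3 p. 1070, (3.34)–(3.38) p. 1071, (5.4)–(5.9) pp. 1089–1092]
-/

noncomputable section

open MeasureTheory Real Finset
open scoped BigOperators

namespace Literature.Probability.FitznerVanDerHofstad2017

open Literature.Barriers.CriticalPhenomena
open Literature.Barriers.CriticalPhenomena.Slade2006Prop53 (P)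

variable {d : ℕ}

/-! ### The pointwise Jensen step -/

/-- **`D̂(k)² ≤ d⁻¹ Σ_s cos²(k_s)`** (`d ≥ 1`; Cauchy–Schwarz on the average `D̂ = d⁻¹ Σ_s cos k_s`).
[cite: FitznerVanDerHofstad2016NoBLE, §3.3.3 p. 1070] -/
theorem Dhat_sq_le_sum_cos_sq_div (hd : 1 ≤ d) (k : Fin d → ℝ) :
    Dhat d k ^ 2 ≤ (∑ j, Real.cos (k j) ^ 2) / d := by
  have hd0 : (0 : ℝ) < d := by exact_mod_cast hd
  have hcs : (∑ j, Real.cos (k j)) ^ 2 ≤ (d : ℝ) * ∑ j, Real.cos (k j) ^ 2 := by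
    have h := sq_sum_le_card_mul_sum_sq (s := (Finset.univ : Finset (Fin d))) (f := fun j => Real.cos (k j))
    simpa only [Finset.card_univ, Fintype.card_fin] using h
  rw [Dhat, div_pow, div_le_div_iff₀ (by positivity) hd0]
  nlinarith [hcs, hd0.le]

/-- **`D̂^{sin}(k) ≤ (1 − D̂(k)²)/d`** (`d ≥ 1`): `d² D̂^{sin}(k) = Σ_s sin² k_s = d − Σ_s cos² k_s ≤ d − d D̂(k)²`.
[cite: FitznerVanDerHofstad2016NoBLE, §3.3.3 p. 1070] -/
theorem Dsin_le_one_sub_Dhat_sq_div (hd : 1 ≤ d) (k : Fin d → ℝ) :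
    Dsin d k ≤ (1 - Dhat d k ^ 2) / d := by
  have hd0 : (0 : ℝ) < d := by exact_mod_cast hd
  have hsin : ∑ j, Real.sin (k j) ^ 2 = d - ∑ j, Real.cos (k j) ^ 2 := by
    rw [eq_sub_iff_add_eq, ← Finset.sum_add_distrib]
    simp only [Real.sin_sq_add_cos_sq, Finset.sum_const, Finset.card_univ, Fintype.card_fin, nsmul_eq_mul,
      mul_one]
  have hD := Dhat_sq_le_sum_cos_sq_div hd k
  rw [le_div_iff₀ hd0] at hD
  rw [Dsin, hsin, div_le_div_iff₀ (by positivity) hd0]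
  nlinarith [hD, hd0.le]

/-! ### The second moment is linear in the weight; `Sq^{|D̂|^{2j}} = W_{n,j}` -/

/-- `Sq^{w₁ − w₂}_n(x) = Sq^{w₁}_n(x) − Sq^{w₂}_n(x)` for bounded measurable weights (`d ≥ 2n+1`).
[cite: FitznerVanDerHofstad2016NoBLE, (3.34) p. 1071; (5.7) p. 1091] -/
theorem srwSqMom_sub_weight {n : ℕ} (hd : 2 * n + 1 ≤ d) {w₁ w₂ : (Fin d → ℝ) → ℝ}
    (h₁ : Measurable w₁) (h₂ : Measurable w₂) {W₁ W₂ : ℝ} (hb₁ : ∀ k, |w₁ k| ≤ W₁)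
    (hb₂ : ∀ k, |w₂ k| ≤ W₂) (x : Fin d → ℤ) :
    srwSqMom d n (fun k => w₁ k - w₂ k) x = srwSqMom d n w₁ x - srwSqMom d n w₂ x := by
  simp only [srwSqMom]
  rw [← sub_div, ← integral_sub (integrable_weight_sq_mul_Chat_pow hd h₁ hb₁ x)
    (integrable_weight_sq_mul_Chat_pow hd h₂ hb₂ x)]
  congr 1
  refine integral_congr_ae (ae_of_all _ fun k => ?_)
  ring

/-- `Sq^{|D̂|^{2j}}_n(x) = W_{n,j}(x)`. [cite: FitznerVanDerHofstad2016NoBLE, (3.34), (3.36) p. 1071; (5.7) p. 1091] -/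
theorem srwSqMom_abs_Dhat_pow_even_eq_srwW (n j : ℕ) (x : Fin d → ℤ) :
    srwSqMom d n (fun k => |Dhat d k| ^ (2 * j)) x = srwW d n j x := by
  simp only [srwSqMom, srwW, (even_two_mul j).pow_abs]

/-- `| |D̂(k)|^l | ≤ 1`. [folklore] -/
private theorem abs_abs_Dhat_pow_le_one (l : ℕ) (k : Fin d → ℝ) : |(|Dhat d k| ^ l)| ≤ 1 := by
  rw [abs_of_nonneg (pow_nonneg (abs_nonneg _) _)]
  exact abs_Dhat_pow_le_one l k

/-! ### The Jensen `U`-row input -/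

/-- **`Sq^{|D̂|^{2j} D̂^{sin}}_n(x) ≤ d⁻¹ (W_{n,j}(x) − W_{n,j+1}(x))`** (`d ≥ 2n+1`): integrate the pointwise
`|D̂|^{2j} D̂^{sin} ≤ d⁻¹ (|D̂|^{2j} − |D̂|^{2j+2})` against the non-negative density `(D̂^{(x)})² Ĉⁿ`.
[cite: FitznerVanDerHofstad2016NoBLE, §3.3.3 p. 1070, (3.34)–(3.38) p. 1071; (5.7), (5.9) pp. 1091–1092] -/
theorem srwSqMom_abs_Dhat_pow_even_mul_Dsin_le_srwW_sub {n : ℕ} (hd : 2 * n + 1 ≤ d) (j : ℕ)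
    (x : Fin d → ℤ) :
    srwSqMom d n (fun k => |Dhat d k| ^ (2 * j) * Dsin d k) x
      ≤ 1 / d * (srwW d n j x - srwW d n (j + 1) x) := by
  have hd1 : 1 ≤ d := by omega
  have hm : ∀ l : ℕ, Measurable fun k : Fin d → ℝ => |Dhat d k| ^ l := fun l =>
    (continuous_Dhat d).measurable.abs.pow_const l
  have hms : Measurable (Dsin d) := by unfold Dsin; fun_prop
  have hsub : srwSqMom d n (fun k => |Dhat d k| ^ (2 * j) - |Dhat d k| ^ (2 * (j + 1))) x
      = srwW d n j x - srwW d n (j + 1) x := by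
    rw [srwSqMom_sub_weight hd (hm _) (hm _) (abs_abs_Dhat_pow_le_one _) (abs_abs_Dhat_pow_le_one _) x,
      srwSqMom_abs_Dhat_pow_even_eq_srwW, srwSqMom_abs_Dhat_pow_even_eq_srwW]
  rw [← hsub, ← srwSqMom_const_mul_weight]
  refine srwSqMom_mono_weight hd (w₁ := fun k => |Dhat d k| ^ (2 * j) * Dsin d k)
    (w₂ := fun k => 1 / (d : ℝ) * (|Dhat d k| ^ (2 * j) - |Dhat d k| ^ (2 * (j + 1))))
    ((hm _).mul hms) (measurable_const.mul ((hm _).sub (hm _)))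
    (W₁ := 1 / d) (W₂ := 1 / d * (1 + 1)) (fun k => ?_) (fun k => ?_) (fun k => ?_) x
  · rw [abs_mul, abs_of_nonneg (Dsin_nonneg k), abs_of_nonneg (pow_nonneg (abs_nonneg _) _)]
    exact (mul_le_mul (abs_Dhat_pow_le_one _ k) (Dsin_le_inv hd1 k) (Dsin_nonneg k) zero_le_one).trans
      (by rw [one_mul])
  · rw [abs_mul, abs_of_nonneg (by positivity : (0 : ℝ) ≤ 1 / d)]
    exact mul_le_mul_of_nonneg_left
      ((abs_sub _ _).trans (add_le_add (abs_abs_Dhat_pow_le_one _ k) (abs_abs_Dhat_pow_le_one _ k)))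
      (by positivity)
  · have hD := Dsin_le_one_sub_Dhat_sq_div hd1 k
    have hp : 0 ≤ |Dhat d k| ^ (2 * j) := pow_nonneg (abs_nonneg _) _
    have hsq : |Dhat d k| ^ (2 * (j + 1)) = |Dhat d k| ^ (2 * j) * Dhat d k ^ 2 := by
      rw [mul_add, mul_one, pow_add, sq_abs]
    rw [hsq]
    calc |Dhat d k| ^ (2 * j) * Dsin d k ≤ |Dhat d k| ^ (2 * j) * ((1 - Dhat d k ^ 2) / d) :=
          mul_le_mul_of_nonneg_left hD hp
      _ = 1 / d * (|Dhat d k| ^ (2 * j) - |Dhat d k| ^ (2 * j) * Dhat d k ^ 2) := by ring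

/-- `W_{n,j}(m e_i)` in plain seeds: `(I_{n,2j}(0) + I_{n,2j}(2m e_i))/(2d) + ((d−1)/d) I_{n,2j}(m e_i + m e_j)` (`i ≠ j`).
[cite: FitznerVanDerHofstad2016NoBLE, (5.4), (5.7) p. 1091; (3.34)–(3.35) p. 1071] -/
theorem srwW_single_eq {n : ℕ} (hd : 2 * n + 1 ≤ d) (l : ℕ) {i j : Fin d} (hij : i ≠ j) (m : ℤ) :
    srwW d n l (Pi.single i m)
      = (srwI d n (2 * l) 0 + srwI d n (2 * l) (Pi.single i (2 * m))) / (2 * d)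
        + ((d : ℝ) - 1) / d * srwI d n (2 * l) (Pi.single i m + Pi.single j m) := by
  rw [← srwSqMom_abs_Dhat_pow_even_eq_srwW]
  exact srwSqMom_abs_Dhat_pow_even_single_eq hd l hij m

/-- The seed combination `(z₀ + z₂)/(2d) + ((d−1)/d) z₁₁` is monotone in `(z₀, z₂, z₁₁)` (`d ≥ 1`). [folklore] -/
private theorem seedComb_mono (hd : 1 ≤ d) {z₀ z₂ z₁₁ Z₀ Z₂ Z₁₁ : ℝ} (h0 : z₀ ≤ Z₀) (h2 : z₂ ≤ Z₂)
    (h11 : z₁₁ ≤ Z₁₁) :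
    (z₀ + z₂) / (2 * d) + ((d : ℝ) - 1) / d * z₁₁ ≤ (Z₀ + Z₂) / (2 * d) + ((d : ℝ) - 1) / d * Z₁₁ := by
  have hd1 : (1 : ℝ) ≤ d := by exact_mod_cast hd
  have hc : (0 : ℝ) ≤ ((d : ℝ) - 1) / d := div_nonneg (by linarith) (by linarith)
  have ha := div_le_div_of_nonneg_right (add_le_add h0 h2) (by linarith : (0 : ℝ) ≤ 2 * d)
  have hb := mul_le_mul_of_nonneg_left h11 hc
  linarith

/-- **`U_{n,0}` row input at an axis node, Jensen form, `ℚ`-cast** (`d ≥ 2n+1`, `i ≠ j`, any `m`): from UPPER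
bounds `I_{n,0}(0) ≤ B₀`, `I_{n,0}(2m e_i) ≤ B₂`, `I_{n,0}(m e_i + m e_j) ≤ B₁₁` and LOWER bounds
`a₀ ≤ I_{n,2}(0)`, `a₂ ≤ I_{n,2}(2m e_i)`, `a₁₁ ≤ I_{n,2}(m e_i + m e_j)`:
`Sq^{|D̂|⁰ D̂^{sin}}_n(m e_i) ≤ d⁻¹ (((B₀ + B₂)/(2d) + ((d−1)/d) B₁₁) − ((a₀ + a₂)/(2d) + ((d−1)/d) a₁₁))`.
[cite: FitznerVanDerHofstad2016NoBLE, (3.38) p. 1071; (5.4), (5.7), (5.9) pp. 1091–1092] -/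
theorem srwSqMom_abs_Dhat_pow_zero_mul_Dsin_single_le_jensen_cast {n : ℕ} (hd : 2 * n + 1 ≤ d)
    {i j : Fin d} (hij : i ≠ j) (m : ℤ) {B₀ B₂ B₁₁ a₀ a₂ a₁₁ : ℚ}
    (h0 : srwI d n 0 0 ≤ (B₀ : ℝ)) (h2 : srwI d n 0 (Pi.single i (2 * m)) ≤ (B₂ : ℝ))
    (h11 : srwI d n 0 (Pi.single i m + Pi.single j m) ≤ (B₁₁ : ℝ))
    (g0 : (a₀ : ℝ) ≤ srwI d n 2 0) (g2 : (a₂ : ℝ) ≤ srwI d n 2 (Pi.single i (2 * m)))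
    (g11 : (a₁₁ : ℝ) ≤ srwI d n 2 (Pi.single i m + Pi.single j m)) :
    srwSqMom d n (fun k => |Dhat d k| ^ 0 * Dsin d k) (Pi.single i m)
      ≤ ((1 / d * (((B₀ + B₂) / (2 * d) + ((d : ℚ) - 1) / d * B₁₁)
          - ((a₀ + a₂) / (2 * d) + ((d : ℚ) - 1) / d * a₁₁)) : ℚ) : ℝ) := by
  have hd1 : 1 ≤ d := by omega
  have h := srwSqMom_abs_Dhat_pow_even_mul_Dsin_le_srwW_sub hd 0 (Pi.single i m)
  rw [Nat.mul_zero, zero_add, srwW_single_eq hd 0 hij m, srwW_single_eq hd 1 hij m, Nat.mul_zero,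
    Nat.mul_one] at h
  have hU := seedComb_mono hd1 h0 h2 h11
  have hL := seedComb_mono hd1 g0 g2 g11
  push_cast
  exact h.trans (mul_le_mul_of_nonneg_left (by linarith) (by positivity))

/-- **`U_{n,2}` row input at an axis node, Jensen form, `ℚ`-cast** (`d ≥ 2n+1`, `i ≠ j`, any `m`): from UPPER
bounds on `I_{n,2}` and LOWER bounds on `I_{n,4}` at `0`, `2m e_i`, `m e_i + m e_j`:
`Sq^{|D̂|² D̂^{sin}}_n(m e_i) ≤ d⁻¹ (((A₀ + A₂)/(2d) + ((d−1)/d) A₁₁) − ((c₀ + c₂)/(2d) + ((d−1)/d) c₁₁))`.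
[cite: FitznerVanDerHofstad2016NoBLE, (3.38) p. 1071; (5.4), (5.7), (5.9) pp. 1091–1092] -/
theorem srwSqMom_abs_Dhat_sq_mul_Dsin_single_le_jensen_cast {n : ℕ} (hd : 2 * n + 1 ≤ d)
    {i j : Fin d} (hij : i ≠ j) (m : ℤ) {A₀ A₂ A₁₁ c₀ c₂ c₁₁ : ℚ}
    (h0 : srwI d n 2 0 ≤ (A₀ : ℝ)) (h2 : srwI d n 2 (Pi.single i (2 * m)) ≤ (A₂ : ℝ))
    (h11 : srwI d n 2 (Pi.single i m + Pi.single j m) ≤ (A₁₁ : ℝ))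
    (g0 : (c₀ : ℝ) ≤ srwI d n 4 0) (g2 : (c₂ : ℝ) ≤ srwI d n 4 (Pi.single i (2 * m)))
    (g11 : (c₁₁ : ℝ) ≤ srwI d n 4 (Pi.single i m + Pi.single j m)) :
    srwSqMom d n (fun k => |Dhat d k| ^ 2 * Dsin d k) (Pi.single i m)
      ≤ ((1 / d * (((A₀ + A₂) / (2 * d) + ((d : ℚ) - 1) / d * A₁₁)
          - ((c₀ + c₂) / (2 * d) + ((d : ℚ) - 1) / d * c₁₁)) : ℚ) : ℝ) := by
  have hd1 : 1 ≤ d := by omega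
  have h := srwSqMom_abs_Dhat_pow_even_mul_Dsin_le_srwW_sub hd 1 (Pi.single i m)
  rw [Nat.mul_one, srwW_single_eq hd 1 hij m, srwW_single_eq hd 2 hij m, Nat.mul_one] at h
  have hU := seedComb_mono hd1 h0 h2 h11
  have hL := seedComb_mono hd1 g0 g2 g11
  push_cast
  exact h.trans (mul_le_mul_of_nonneg_left (by linarith) (by positivity))

/-! ### The unit axis node: the second moment is a `β = 0` class mass -/

/-- **`Sq^{w}_n(e_i) = Tw^{w·D̂²}_n(x; 0)`**: at the unit axis node `D̂^{(e_i)} = D̂`, so the second-moment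
density is the weight `D̂²` at `β = 0` (any marked point `x`).
[cite: FitznerVanDerHofstad2016NoBLE, (3.34)–(3.36) p. 1071] -/
theorem srwSqMom_single_one_eq_srwTwist_zero (n : ℕ) (w : (Fin d → ℝ) → ℝ) (i : Fin d) (x : Fin d → ℤ) :
    srwSqMom d n w (Pi.single i 1) = srwTwist d n (fun k => w k * Dhat d k ^ 2) x 0 := by
  simp only [srwSqMom, srwTwist, DhatSym_single, zero_mul, Real.cos_zero, mul_one]

/-- **`Sq^{|D̂|^l D̂^{sin}}_n(e_i) = Tw^{|D̂|^{l+2} D̂^{sin}}_n(x; 0)`** — the `U_{n,l}` row input at the unit axis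
node is the `β = 0` mass of the weight class `|D̂|^{l+2} D̂^{sin}` (for `l = 0` enclosed by the landed
`srwTwist_abs_Dhat_sq_mul_Dsin_encl`). [cite: FitznerVanDerHofstad2016NoBLE, (3.34)–(3.38) p. 1071] -/
theorem srwSqMom_abs_Dhat_pow_mul_Dsin_single_one_eq (n l : ℕ) (i : Fin d) (x : Fin d → ℤ) :
    srwSqMom d n (fun k => |Dhat d k| ^ l * Dsin d k) (Pi.single i 1)
      = srwTwist d n (fun k => |Dhat d k| ^ (l + 2) * Dsin d k) x 0 := by
  rw [srwSqMom_single_one_eq_srwTwist_zero]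
  congr 1
  funext k
  rw [pow_add, sq_abs]
  ring

end Literature.Probability.FitznerVanDerHofstad2017

end
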